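import Summits.CriticalPhenomena.PercolationContinuityZ3.Theorems.PercNearOneGluingNoHeavyLowerTailSahiTwoLevelSharedLadder

/-!
# THE SHARED-COINS LADDER FROM THE BOTTOM LAW ALONE: `twoLevelForm ≥ 0` for tops sharing `≤ k` coins ⟹ Kahn's `C_3` for two events sharing `≤ k + 1` coins

Companion of `…SahiTwoLevelSharedLadder` (cell `prim-bnk`, seat bnk-2 gen 17; `--supports stmt-CriticalPhenomena-4575`; memo
`run/shared/lean/prim/prim-l12/FROM-prim-bnk-2-g17-POLARIZATION.md` §4).  No definition, no sorry, standard axioms.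

`…SahiTwoLevelSharedLadder` climbs one shared coin by the one-coordinate BERNSTEIN form of `E_3`, whose two middle coefficients are the
two two-level laws `T ≥ 0` (`twoLevelForm`, "C₃-M⁻") AND `T⁺ = T − ∏δ ≥ 0` ("C₃-M⁺") at the sections.  This file climbs the same coin with
the LOG-DERIVATIVE SCHEMA of `…SahiLogDerivEndC3` instead (`2Φ + (1−x)Φ′ ≥ 0` on `[0,1)` and `Φ(0) ≥ 0` force `Φ ≥ 0`): along a shared coin
`e`, `2Φ(x) + (1−x)Φ′(x)` is — after the PARALLEL substitution of that file (`parBlock`: `x_e ↦ x_{some e} ∨ x_{none}` on `Option (Fin r)`) —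
the BOTTOM form `T` of the sections along the new coin `none`, whose TOPS are lifts of the `e ← 1` sections of the original events (so they
share one coin fewer) while the BOTTOMS still depend on `some e` (`determinedBy_secAt_true_subst_parBlock`).  Hence:

**THEOREM (`sahiE_three_nonneg_of_twoLevelSharedBottom`, cube `Fin r`).**  IF `twoLevelForm ≥ 0` holds (on every finite cube, every product
weight) at every nested pair of increasing triples `H ⊆ G` whose tops `G 0`, `G 1` are determined by sets sharing `≤ k` coins — bottoms
UNRESTRICTED — THEN `E_3(μ_p; 1_A, 1_B, 1_C) ≥ 0` for all increasing `A`, `B` determined by sets sharing `≤ k + 1` coins and every increasing `C`.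

Compared with the Bernstein ladder the hypothesis drops the TOP law `T⁺ ≥ 0` entirely (but needs arbitrary nested bottoms, where the
Bernstein ladder can be restricted to bottoms determined by the same supports, `sahiE_three_nonneg_of_twoLevelShared_weak`); the two
reductions are incomparable.  Rung `k = 0` of either hypothesis is the independent-tops theorem (`twoLevelShared_zero`); rung `k = 1`
(`twoLevelForm ≥ 0` for tops sharing ONE coin) is OPEN and census-clean and would give Kahn's `C_3` for two events sharing `≤ 2` coins
(`sahiE_three_nonneg_of_card_inter_le_two_of_twoLevelSharedBottomOne`).  Kahn's Conjecture 5 itself remains OPEN. [this work]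
-/

noncomputable section

open scoped Classical

namespace Summit.CriticalPhenomena.PercolationContinuityZ3.Theorems

namespace SahiTwoLevelIndep

open Finset Function MeasureTheory
open Literature.Combinatorics.Sahi2008
open Literature.Probability.LatticeModels (prodBernoulli prodBernoulli_sahiE3_nonneg_of_determinedBy)
open Literature.Probability.Percolation (DeterminedBy determinedBy_iff)
open Literature.Probability.Percolation.DecisionTree (ind)
open SahiComb SahiCombSubstitution SahiLogDerivEnd

attribute [local instance 1001] Classical.propDecidable

variable {r : ℕ}

/-- **The tops of the `none`-sections after the parallel substitution are determined by the image of `S ∖ {e}`**: for an event `A`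
determined by `S ⊆ Fin r`, the `none ← 1` section of `subst (parBlock e) A` (an event on `Option (Fin r)`) is determined by
`some '' (S ∖ {e})` — it no longer sees the coordinate `some e`. [this work] -/
theorem determinedBy_secAt_true_subst_parBlock (e : Fin r) {A : Set (Set (Fin r))} {S : Finset (Fin r)}
    (hA : DeterminedBy A (↑S : Set (Fin r))) :
    DeterminedBy (secAt none true (subst (parBlock e) A))
      (↑((S.erase e).map Function.Embedding.some) : Set (Option (Fin r))) := by
  rw [determinedBy_iff] at hA ⊢
  intro ω ω' h
  rw [mem_secAt, mem_secAt]
  show bits (parBlock e) (forceAt none true ω) ∈ A ↔ bits (parBlock e) (forceAt none true ω') ∈ A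
  refine hA _ _ ?_
  -- the two bit vectors agree on `S`
  have hbit : ∀ (ω'' : Set (Option (Fin r))) (j : Fin r),
      j ∈ bits (parBlock e) (forceAt none true ω'') ↔ (j = e ∨ some j ∈ ω'') := by
    intro ω'' j
    show forceAt none true ω'' ∈ parBlock e j ↔ _
    by_cases hje : j = e
    · subst hje
      simp [parBlock, forceAt]
    · simp [parBlock, hje, forceAt]
  ext j
  simp only [Set.mem_inter_iff, Finset.mem_coe, hbit]
  by_cases hje : j = e
  · simp [hje]
  · by_cases hjS : j ∈ S
    · have hin : some j ∈ (↑((S.erase e).map Function.Embedding.some) : Set (Option (Fin r))) := by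
        simp [hjS, hje]
      have key := Set.ext_iff.1 h (some j)
      simp only [Set.mem_inter_iff, hin, and_true] at key
      simp [hje, hjS, key]
    · simp [hjS]

/-- Card bookkeeping: the images of `S₀ ∖ {e}`, `S₁ ∖ {e}` share `|S₀ ∩ S₁| − 1` points when `e ∈ S₀ ∩ S₁`. [folklore] -/
theorem card_map_some_erase_inter_le (S₀ S₁ : Finset (Fin r)) (e : Fin r) (he : e ∈ S₀ ∩ S₁) {k : ℕ}
    (hS : (S₀ ∩ S₁).card ≤ k + 1) :
    ((S₀.erase e).map Function.Embedding.some ∩ (S₁.erase e).map Function.Embedding.some).card ≤ k := by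
  have h1 : (S₀.erase e).map Function.Embedding.some ∩ (S₁.erase e).map Function.Embedding.some
      = ((S₀ ∩ S₁).erase e).map Function.Embedding.some := by
    ext z
    simp only [Finset.mem_inter, Finset.mem_map, Finset.mem_erase, Function.Embedding.some_apply]
    constructor
    · rintro ⟨⟨a, ⟨hae, haS⟩, rfl⟩, ⟨b, ⟨hbe, hbS⟩, hb⟩⟩
      have hab : b = a := Option.some_injective _ hb
      subst hab
      exact ⟨b, ⟨hbe, haS, hbS⟩, rfl⟩
    · rintro ⟨a, ⟨hae, haS, hbS⟩, rfl⟩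
      exact ⟨⟨a, ⟨hae, haS⟩, rfl⟩, ⟨a, ⟨hae, hbS⟩, rfl⟩⟩
  rw [h1, Finset.card_map, Finset.card_erase_of_mem he]
  exact tsub_le_iff_right.2 hS

/-- **The schema inequality along a shared coin, from the BOTTOM law at one shared coin fewer.**  If `twoLevelForm ≥ 0` holds at every
nested pair whose tops are determined by sets sharing `≤ k` coins (all finite cubes, bottoms unrestricted), then along every coin `e`
shared by `U 0` (determined by `S₀`) and `U 1` (determined by `S₁`), `|S₀ ∩ S₁| ≤ k + 1`, the fibre cubic `Φ` of `E_3` satisfies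
`2Φ(x) + (1−x)Φ′(x) ≥ 0` on `[0,1]` (parallel substitution, as in `SahiLogDerivEnd.logDeriv_nonneg_of_end`). [this work] -/
theorem logDeriv_nonneg_of_twoLevelSharedBottom (k : ℕ)
    (hT : ∀ (κ : Type) [Fintype κ] (q : κ → unitInterval) (S₀ S₁ : Finset κ) (G H : Fin 3 → Set (Set κ)),
      (∀ i, IsUpperSet (G i)) → (∀ i, IsUpperSet (H i)) → (∀ i, H i ⊆ G i) →
      DeterminedBy (G 0) (↑S₀ : Set κ) → DeterminedBy (G 1) (↑S₁ : Set κ) → (S₀ ∩ S₁).card ≤ k →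
        0 ≤ twoLevelForm (fun X => ex (bernoulliWeight q) (ind X)) G H)
    (p : Fin r → unitInterval) (e : Fin r) (S₀ S₁ : Finset (Fin r)) (U : Fin 3 → Set (Set (Fin r)))
    (hU : ∀ i, IsUpperSet (U i)) (h0 : DeterminedBy (U 0) (↑S₀ : Set (Fin r))) (h1 : DeterminedBy (U 1) (↑S₁ : Set (Fin r)))
    (he : e ∈ S₀ ∩ S₁) (hS : (S₀ ∩ S₁).card ≤ k + 1) {x : ℝ} (hx0 : 0 ≤ x) (hx1 : x ≤ 1) :
    0 ≤ 2 * cubicE3 p e (ind (U 0)) (ind (U 1)) (ind (U 2)) x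
      + (1 - x) * deriv (cubicE3 p e (ind (U 0)) (ind (U 1)) (ind (U 2))) x := by
  set σ : unitInterval := ⟨x, hx0, hx1⟩ with hσ
  set p' : Option (Fin r) → unitInterval := SahiCombTopC3.serBase p e σ with hp'
  set U' : Fin 3 → Set (Set (Option (Fin r))) := fun i => subst (parBlock e) (U i) with hU'def
  have hU' : ∀ i, IsUpperSet (U' i) := fun i => isUpperSet_subst (fun j => isUpperSet_parBlock e j) (hU i)
  -- the bottom law at the `none`-sections of `U'`: tops determined by the images of `S₀ ∖ {e}`, `S₁ ∖ {e}`
  have hbig : 0 ≤ 2 * cubicE3 p' none (ind (U' 0)) (ind (U' 1)) (ind (U' 2)) 0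
      + derivE3AtZero p' none (ind (U' 0)) (ind (U' 1)) (ind (U' 2)) := by
    rw [← SahiTwoLevel.twoLevelForm_secAt_eq p' none U']
    exact hT (Option (Fin r)) p' ((S₀.erase e).map Function.Embedding.some) ((S₁.erase e).map Function.Embedding.some)
      (fun i => secAt none true (U' i)) (fun i => secAt none false (U' i))
      (fun i => isUpperSet_secAt none true (hU' i)) (fun i => isUpperSet_secAt none false (hU' i))
      (fun i => SahiTwoLevel.secAt_false_subset_true none (hU' i))
      (determinedBy_secAt_true_subst_parBlock e h0) (determinedBy_secAt_true_subst_parBlock e h1)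
      (card_map_some_erase_inter_le S₀ S₁ e he hS)
  rw [logDerivEnd_eq_fourPoint] at hbig
  -- the big fibre cubic at `y` is the small one at `x + (1 − x) y`
  have hval : ∀ (y : ℝ) (hy0 : 0 ≤ y) (hy1 : y ≤ 1),
      cubicE3 p' none (ind (U' 0)) (ind (U' 1)) (ind (U' 2)) y =
        cubicE3 p e (ind (U 0)) (ind (U 1)) (ind (U 2)) (x + (1 - x) * y) := by
    intro y hy0 hy1
    have h1 := sahiE_three_ind_update_eq p' none ⟨y, hy0, hy1⟩ U'
    have hp'0 : update p' none (⟨y, hy0, hy1⟩ : unitInterval) = update (SahiCombTopC3.serBase p e σ) none ⟨y, hy0, hy1⟩ := rfl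
    rw [hp'0, hU'def, sahiE_parSubst, sahiE_three_ind_update_eq] at h1
    have hcoe : ((unitInterval.symm (unitInterval.symm σ * unitInterval.symm (⟨y, hy0, hy1⟩ : unitInterval)) : unitInterval) : ℝ) =
        x + (1 - x) * y := by
      rw [unitInterval.coe_symm_eq, Set.Icc.coe_mul, unitInterval.coe_symm_eq, unitInterval.coe_symm_eq]
      simp only [hσ]
      ring
    have hcoe' : ((⟨y, hy0, hy1⟩ : unitInterval) : ℝ) = y := rfl
    rw [hcoe, hcoe'] at h1
    exact h1.symm
  rw [hval 0 le_rfl zero_le_one, hval (1 / 3) (by norm_num) (by norm_num), hval (2 / 3) (by norm_num) (by norm_num),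
    hval 1 zero_le_one le_rfl] at hbig
  have e0 : x + (1 - x) * 0 = x := by ring
  rw [e0, fourPoint_reparam] at hbig
  exact hbig

/-- **THE BOTTOM-LAW LADDER** (cube `Fin r`).  If `twoLevelForm ≥ 0` holds on every finite cube at every nested pair of increasing triples
whose tops `G 0`, `G 1` are determined by sets sharing at most `k` coins (bottoms unrestricted), then for every `j ≤ k + 1`, every
product weight `p` on `Fin r`, all increasing `U 0` (determined by `S₀`), `U 1` (determined by `S₁`) with `|S₀ ∩ S₁| ≤ j` and every
increasing `U 2`: `E_3(μ_p; 1_{U 0}, 1_{U 1}, 1_{U 2}) ≥ 0`.  Induction on `j`; base = independent tops; step = the log-derivative schema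
along a shared coin (`logDeriv_nonneg_of_twoLevelSharedBottom` + `LogDerivSchema.nonneg_of_logDeriv_nonneg`). [this work] -/
theorem sahiE_three_nonneg_of_twoLevelSharedBottom (k : ℕ)
    (hT : ∀ (κ : Type) [Fintype κ] (q : κ → unitInterval) (S₀ S₁ : Finset κ) (G H : Fin 3 → Set (Set κ)),
      (∀ i, IsUpperSet (G i)) → (∀ i, IsUpperSet (H i)) → (∀ i, H i ⊆ G i) →
      DeterminedBy (G 0) (↑S₀ : Set κ) → DeterminedBy (G 1) (↑S₁ : Set κ) → (S₀ ∩ S₁).card ≤ k →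
        0 ≤ twoLevelForm (fun X => ex (bernoulliWeight q) (ind X)) G H) :
    ∀ (j : ℕ), j ≤ k + 1 → ∀ (p : Fin r → unitInterval) (S₀ S₁ : Finset (Fin r)) (U : Fin 3 → Set (Set (Fin r))),
      (∀ i, IsUpperSet (U i)) → DeterminedBy (U 0) (↑S₀ : Set (Fin r)) → DeterminedBy (U 1) (↑S₁ : Set (Fin r)) →
      (S₀ ∩ S₁).card ≤ j → 0 ≤ sahiE (bernoulliWeight p) 3 (fun i => ind (U i)) := by
  intro j
  induction j with
  | zero =>
    intro _ p S₀ S₁ U hU h0 h1 hS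
    have hd : Disjoint S₀ S₁ := Finset.disjoint_iff_inter_eq_empty.2 (Finset.card_eq_zero.1 (Nat.le_zero.1 hS))
    have hvec : (fun i => ind (U i)) = ![ind (U 0), ind (U 1), ind (U 2)] := by
      funext i; fin_cases i <;> rfl
    rw [hvec, sahiE_three_ind]
    exact prodBernoulli_sahiE3_nonneg_of_determinedBy p hd h0 h1 (hU 0) (hU 1) (hU 2) MeasurableSet.of_discrete
      MeasurableSet.of_discrete MeasurableSet.of_discrete
  | succ j ih =>
    intro hj p S₀ S₁ U hU h0 h1 hS
    by_cases hle : (S₀ ∩ S₁).card ≤ j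
    · exact ih (Nat.le_of_succ_le hj) p S₀ S₁ U hU h0 h1 hle
    · have hpos : 0 < (S₀ ∩ S₁).card := lt_of_le_of_lt (Nat.zero_le _) (Nat.lt_of_not_le hle)
      obtain ⟨e, he⟩ := Finset.card_pos.1 hpos
      -- `Φ(0) ≥ 0`: the `0`-sections share one coin fewer
      have hsec0 : DeterminedBy (secAt e false (U 0)) (↑(S₀.erase e) : Set (Fin r)) := determinedBy_secAt e false h0
      have hsec1 : DeterminedBy (secAt e false (U 1)) (↑(S₁.erase e) : Set (Fin r)) := determinedBy_secAt e false h1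
      have hcard : (S₀.erase e ∩ S₁.erase e).card ≤ j := by
        have h1' : S₀.erase e ∩ S₁.erase e = (S₀ ∩ S₁).erase e := by
          ext x; simp only [Finset.mem_inter, Finset.mem_erase]; tauto
        rw [h1', Finset.card_erase_of_mem he]
        exact tsub_le_iff_right.2 hS
      have hΦ0 : 0 ≤ cubicE3 p e (ind (U 0)) (ind (U 1)) (ind (U 2)) 0 := by
        rw [cubicE3_zero_eq_secAt]
        exact ih (Nat.le_of_succ_le hj) p (S₀.erase e) (S₁.erase e) (fun i => secAt e false (U i))
          (fun i => isUpperSet_secAt e false (hU i)) hsec0 hsec1 hcard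
      -- `2Φ + (1−x)Φ′ ≥ 0` on `[0,1)` from the bottom law at `≤ k` shared coins
      have hM : ∀ x ∈ Set.Ico (0 : ℝ) 1, 0 ≤ 2 * cubicE3 p e (ind (U 0)) (ind (U 1)) (ind (U 2)) x
          + (1 - x) * deriv (cubicE3 p e (ind (U 0)) (ind (U 1)) (ind (U 2))) x :=
        fun x hx => logDeriv_nonneg_of_twoLevelSharedBottom k hT p e S₀ S₁ U hU h0 h1 he (hS.trans hj) hx.1 hx.2.le
      have hmain := LogDerivSchema.nonneg_of_logDeriv_nonneg (differentiable_cubicE3 p e _ _ _) hΦ0 hM (p e)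
        ⟨(p e).2.1, (p e).2.2⟩
      have hE := sahiE_three_ind_update_eq p e (p e) U
      rw [update_eq_self] at hE
      rw [hE]
      exact hmain

/-- **Rung `k = 1`, bottom-law form**: `twoLevelForm ≥ 0` ("C₃-M⁻") at every nested pair whose tops share ONE coin (bottoms unrestricted;
OPEN, census-clean) would give Kahn's `C_3` for every triple of increasing events on `Fin r` two of which are determined by sets sharing
at most TWO coins. [this work] -/
theorem sahiE_three_nonneg_of_card_inter_le_two_of_twoLevelSharedBottomOne
    (hT : ∀ (κ : Type) [Fintype κ] (q : κ → unitInterval) (S₀ S₁ : Finset κ) (G H : Fin 3 → Set (Set κ)),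
      (∀ i, IsUpperSet (G i)) → (∀ i, IsUpperSet (H i)) → (∀ i, H i ⊆ G i) →
      DeterminedBy (G 0) (↑S₀ : Set κ) → DeterminedBy (G 1) (↑S₁ : Set κ) → (S₀ ∩ S₁).card ≤ 1 →
        0 ≤ twoLevelForm (fun X => ex (bernoulliWeight q) (ind X)) G H)
    (p : Fin r → unitInterval) {S₀ S₁ : Finset (Fin r)} {A B C : Set (Set (Fin r))}
    (hA : IsUpperSet A) (hB : IsUpperSet B) (hC : IsUpperSet C)
    (hAS : DeterminedBy A (↑S₀ : Set (Fin r))) (hBS : DeterminedBy B (↑S₁ : Set (Fin r))) (hS : (S₀ ∩ S₁).card ≤ 2) :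
    0 ≤ Literature.Probability.LatticeModels.sahiE3 (prodBernoulli p) A B C := by
  rw [← sahiE_three_ind]
  have hU : ∀ i, IsUpperSet ((![A, B, C] : Fin 3 → Set (Set (Fin r))) i) := by
    intro i; fin_cases i
    · exact hA
    · exact hB
    · exact hC
  have h := sahiE_three_nonneg_of_twoLevelSharedBottom 1 hT 2 le_rfl p S₀ S₁ ![A, B, C] hU hAS hBS hS
  have hvec : (fun i => ind ((![A, B, C] : Fin 3 → Set (Set (Fin r))) i)) = ![ind A, ind B, ind C] := by
    funext i; fin_cases i <;> rfl
  rw [hvec] at h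
  exact h

/-- **The rung `k = 0` of the bottom-law hypothesis is a theorem** (independent tops; `twoLevelShared_zero`). [this work] -/
theorem twoLevelSharedBottom_zero (κ : Type) [Fintype κ] (q : κ → unitInterval) (S₀ S₁ : Finset κ) (G H : Fin 3 → Set (Set κ))
    (hG : ∀ i, IsUpperSet (G i)) (hH : ∀ i, IsUpperSet (H i)) (hHG : ∀ i, H i ⊆ G i)
    (h0 : DeterminedBy (G 0) (↑S₀ : Set κ)) (h1 : DeterminedBy (G 1) (↑S₁ : Set κ)) (hS : (S₀ ∩ S₁).card ≤ 0) :
    0 ≤ twoLevelForm (fun X => ex (bernoulliWeight q) (ind X)) G H :=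
  (twoLevelShared_zero q S₀ S₁ G H hG hH hHG h0 h1 hS).1

end SahiTwoLevelIndep

end Summit.CriticalPhenomena.PercolationContinuityZ3.Theorems
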